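import Summits.AtomisticToContinuum.Crystallization.Theorems.ChartedZeroExcessLayeredLatticeLiouvilleZB

/-!
# Part ZC «ClusterGap / BondLabel» (lens-2 g77): the straddling-star gap lemmas PROVED over explicit coordinates, and (SV) cut through the door's
GLOBAL BOND CHART into (GL) ∧ (GC); the junction PROVED

(PRE-CUT SPLIT for the 400-line cap — THIS FILE IS PART A: it contains §ZC-1 (windows and gaps), §ZC-2b (hollow-coset gap) and §ZC-2c (Barlow pair gap) ONLY; the straddling-atom coordinates and dichotomies of §ZC-2 (`straddlePt`, `dist_sq_*_straddlePt`, `straddle_dichotomy_of_clean`, `straddle_dichotomy_of_tame`, `straddle_dichotomy_of_tame_barlow`) and all of §ZC-3 (`IsBondLabel`, `BondLabelP`, `BondCoherenceP`, `singleVariantP_of_bondLabel`, …) live in the SEQUEL `…ChartedZeroExcessLayeredLatticeLiouvilleZC`, which imports this file.  The overview below describes the whole node = part A + sequel; landing-lane note, hand-2 g36.)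

Docket `stmt-AtomisticToContinuum-26636` (N = `…Theses.ChartedPlanarOrder.ChartedZeroExcessLayered`), cell decomp-a2c RESIDUAL MODE, lens-2 «structural
dichotomy (special vs generic)», generation 77.  Imports part ZB (g76, NODE 76 «VariantLabel»: loose-ball residual (SV) `SingleVariantP`, ADMITTED critic
row 1363).  ORDERS (row 1363 (3)): «first typed-and-proved sub-lemma “straddling-star / cluster-gap” … finite metric geometry over explicit coordinates,
norm_num/polyrith scale; (LN)-(β) second and only after census Row-T».  0 sorry; standard axioms.

## ZC-1  Windows and gaps (PROVED, rotation-free, general `(ε, aLo, aHi)`)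
* `windows_of_isTwoShellGoodSet` — a clean point sees every other point within `3a/2` at distance within `εa` of `a` or of `√2·a` (the isometry `A` of
  `IsTwoShellGoodSet` is eliminated by `|‖u‖ − ‖v‖| ≤ ‖u − v‖` and `‖pattern vector‖ ∈ {1, √2}`).
* `not_isTwoShellGoodSet_of_gap` — a neighbour at distance in `((1+ε)aHi, (√2−ε)aLo)` kills cleanliness.
* `door_pair_gap` / `door_pair_gap'` — ★ NO TWO ATOMS OF A DOOR SET lie at a distance in `((17/16)aHi, (9/10)(√2 − 1/16)) ⊇ ((17/16)aHi, 6/5]`.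
* `door_bond_iff` / `isBond_iff_of_isDoorSetP` — N's chart threshold `28/25` sits IN the gap: chart bonds = first-shell contacts `≤ (17/16)aHi`, exactly.
* `not_isTameStar_of_gap` — a model `H` with no pair distance in `(D₁, D₂)` and a star bond in `(D₁+ϑ, D₂−ϑ)` ⇒ the star is not `ϑ`-tame
  (`U` is an isometry; `g` maps the star into `H`).

## ZC-2  The straddling star over explicit coordinates (PROVED, `nlinarith` scale) — the registry-shift DICHOTOMY of one atom
Lower rhombus `0, u, v, u+v` of the unit triangular layer; upper atom `straddlePt σ = (1+σ)·w + √(2/3)·e₃` on the hollow segment `B → C` (`σ ∈ [0,1]`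
in hollow units; lateral shift `s = σ/√3` contact units).  Squared bond lengths: receding `((1+σ)²+2)/3`, approaching `((2−σ)²+2)/3`, shared
`(σ²−σ+3)/3` (`dist_sq_*_straddlePt`).  ★ `straddle_dichotomy_of_clean`: clean at any ceiling `aHi ≤ 1` ⇒ `σ < 9/50 ∨ σ > 41/50` (the shift is SMALL,
`s < 0.104`, or COMPLETES TO THE OTHER LETTER) — from `not_clean_straddle_receding` (`σ ∈ [9/50, 14/25]`) and `…_approaching` (`σ ∈ [11/25, 41/50]`).
★ `straddle_dichotomy_of_tame`: `1/10`-tame relative to a model with pair gap `(1, √2)` ⇒ `σ < 11/50 ∨ σ > 39/50`, i.e. `s ∉ (0.127, 0.450)` — the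
interval `(0.125, 0.452)` of row 1363.  HONEST SCOPE: the tame form takes the model's pair gap as a HYPOTHESIS (ideal Barlow stackings have `(1, √2)`;
the chart crystal `H = LayeredHom L w` has `(a_H(1+s′), a_H(√2−s′))`, to be supplied); from «`H` clean» alone the distance-only tame exclusion is EMPTY
(gap width `0.154 < 2ϑp`).  ZC-2b `norm_sq_lattice_add_hollow`: a hollow is at squared lateral distance `(i²+ij+j²+i+j) + 1/3 ∈ {1/3, 4/3, …}` from
every lattice site — stacking LETTERS ARE DISCRETE (readable at any tolerance `< 1/(2√3) ≈ 0.29 ≫ ϑp`).  ZC-2c `barlow_pair_gap`: in EVERY ideal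
Barlow stacking `barlowStacking 1 √(2/3) s` (fcc, hcp, mixed) a squared pair distance is an INTEGER or `≥ 8/3` (`barlow_dist_sq_integer_or_far`), so no
pair distance lies in `(1, √2)` — the model gap is DISCHARGED for ideal models and `straddle_dichotomy_of_tame_barlow` is UNCONDITIONAL for them.

## ZC-3  NODE 77 «BondLabel»: (SV) ⟸ (GL) `BondLabelP` ∧ (GC) `BondCoherenceP` (junction `singleVariantP_of_bondLabel` PROVED)
THE LENS, applied to (SV)'s two contents.  (SV) asks for ONE map `lab` into the shell crystal `C` that is (i)/(iv) pinned on the collar AND (ii)/(iii)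
metrically coherent on tame stars.  The door is CHARTED (`IsCharted (μS S)` ∈ `IsDoorSetP`, not used as a lever by g43–g76): `S` IS one Barlow stacking as a
CONTACT GRAPH, and by ZC-1 the contact graph is canonical (threshold anywhere in the pair gap).  So the existence half of (SV) is a statement about
GRAPHS — (GL): a BOND LABEL exists (`IsBondLabel`: into `C`, bonds ↦ bonds, injective on the zone, REG-out on the cool zone; built sheet-wise along the
chart's GLOBAL layers, which all cross the collar — no confined lamella is a union of global sheets) — and the metric half is LOCAL and adversary-free —
(GC): EVERY bond label is coherent on `ϑp`-tame stars (a bond label on a clean tame `4`-star is an injective contact-homomorphism of a Barlow cluster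
into `C`, forced to be a lattice relabelling; budget `ϑp + 2ϑr + η_H ≤ ϑp + τ`).  Both pieces are WEAKER IN KIND than (SV) ((GL): no metric clause on
loose atoms; (GC): no existence), neither is N or (QE) restated (bc7 ×2 CLEAN incl. C→S), and the junction is `∃/∀`-composition.
NEW FINDING (why (GC) might fail = a hidden dependency of (SV) at `τ = 1/3000`): REPRODUCIBILITY `η_H ≤ τ − 2ϑr ≈ 1.3·10⁻⁴` of the equilibrium chart
crystal's radius-`4` environments (registry modes of single-site-Nash layered homs; letter-dependent spacings in mixed words) — instrument «Row-R».
Pattern-TYPE confusion is excluded by the bottleneck gap `√2 − 1` between the centred cuboctahedron and anticuboctahedron over all bijections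
(exhaustive branch-and-bound, cell folder `dev/distortion.py`).

TAGS. (GL) UNDECIDED→TRUE-leaning · ATTACKABLE-M · «Row-G»; (GC) UNDECIDED · ATTACKABLE-S/M · «Row-R»; ZC-1/ZC-2/ZC-2b/ZC-2c and the junction PROVED.
Census instrument «Variant-T» of (SV) unchanged; (LN)-(β) NOT touched (orders: after Row-T).
-/

noncomputable section
open scoped BigOperators Classical InnerProductSpace RealInnerProductSpace
open MeasureTheory Set Metric Filter Topology
open Summit.AtomisticToContinuum.Crystallization.Theorems.ChartedPlanarOrderRigidityDoor (E3 IsClean IsCharted)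
open Summit.AtomisticToContinuum.Crystallization.Theorems.ChartedPlanarOrderDensityDichotomy (μS IsSep)
open Summit.AtomisticToContinuum.Crystallization.Theorems.ChartedPlanarOrderCleanScaleP (IsCleanP IsDoorSetP isCleanP_one_iff isCleanP_mono)
open Summit.AtomisticToContinuum.Crystallization.Theorems.ChartedPlanarOrderMesoCut (LayeredHom EnvClose)
open Summit.AtomisticToContinuum.Crystallization.Theorems.ChartedPlanarOrderDoorLayeredOsc (IsTwoShellAffineGood mem_iff_μS_singleton_ne_zero)
open Literature.MathematicalPhysics.StatisticalMechanics (lennardJones triangularVec₁ triangularVec₂ barlowOffset layerNormal)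
open Literature.Geometry.DiscreteGeometry (IsTwoShellGoodSet fccTwoShellPattern hcpTwoShellPattern norm_of_mem_fccTwoShellPattern
  norm_of_mem_hcpTwoShellPattern)

namespace Summit.AtomisticToContinuum.Crystallization.Theorems.ChartedZeroExcessLayeredLatticeLiouville

/-! ### ZC-1  Distance windows of a clean point · the PAIR GAP of a door set · the tame gap (all PROVED, rotation-free) -/

section Windows

/-- `1.4142 < √2 < 1.4143`. [this file, g77] -/
theorem sqrt_two_window : (14142 / 10000 : ℝ) < Real.sqrt 2 ∧ Real.sqrt 2 < 14143 / 10000 := by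
  constructor <;> nlinarith [Real.sq_sqrt (show (0 : ℝ) ≤ 2 by norm_num), Real.sqrt_nonneg 2]

/-- ★ **THE TWO DISTANCE WINDOWS OF A CLEAN POINT (PROVED)**: if `q` is `(ε, aLo, aHi)`-two-shell-good in `Y` (`0 ≤ aLo`), then at the witnessing
scale `a ∈ [aLo, aHi]` every other point `y ∈ Y` within `3a/2` of `q` lies at distance within `ε a` of `a` (first shell) or of `√2·a` (second shell) —
the pattern vectors have norm `1` or `√2` (`norm_of_mem_{fcc,hcp}TwoShellPattern`) and `| ‖y − q‖ − ‖a • A v‖ | ≤ ‖(y − q) − a • A v‖ ≤ ε a`.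
Rotation-free (the isometry `A` is eliminated). [this file, g77] -/
theorem windows_of_isTwoShellGoodSet {ε aLo aHi : ℝ} (hlo : 0 ≤ aLo) {Y : Set E3} {q : E3} (h : IsTwoShellGoodSet ε aLo aHi Y q) :
    ∃ a : ℝ, aLo ≤ a ∧ a ≤ aHi ∧ ∀ y ∈ Y, y ≠ q → dist y q ≤ 3 / 2 * a →
      |dist y q - a| ≤ ε * a ∨ |dist y q - Real.sqrt 2 * a| ≤ ε * a := by
  obtain ⟨a, ha₁, ha₂, A, P, f, hP, hf, -, hsurj⟩ := h
  refine ⟨a, ha₁, ha₂, fun y hy hyq hd => ?_⟩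
  obtain ⟨v, hv, rfl⟩ := hsurj y hy hyq hd
  have ha0 : 0 ≤ a := hlo.trans ha₁
  have hclose : dist (f v) (q + a • A v) ≤ ε * a := (hf v hv).2
  have hnv : ‖v‖ = 1 ∨ ‖v‖ = Real.sqrt 2 := by
    rcases hP with rfl | rfl
    exacts [norm_of_mem_fccTwoShellPattern hv, norm_of_mem_hcpTwoShellPattern hv]
  have hav : ‖a • A v‖ = a * ‖v‖ := by rw [norm_smul, LinearIsometry.norm_map, Real.norm_of_nonneg ha0]
  have htri : |dist (f v) q - ‖a • A v‖| ≤ ε * a := by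
    rw [dist_eq_norm] at hclose ⊢
    have e : f v - (q + a • A v) = (f v - q) - a • A v := by abel
    rw [e] at hclose
    exact (abs_norm_sub_norm_le _ _).trans hclose
  rcases hnv with h1 | h2
  · left; rwa [hav, h1, mul_one] at htri
  · right; rwa [hav, h2, mul_comm a] at htri

/-- ★ **GAP EXCLUSION (PROVED)**: a point `q` having another point `y ∈ Y` at distance STRICTLY BETWEEN the two windows — `(1 + ε)·aHi < dist y q <
(√2 − ε)·aLo` — is NOT `(ε, aLo, aHi)`-two-shell-good (`0 ≤ ε`, `0 < aLo`).  At the door's window `(1/16, 9/10, 1)` the forbidden gap is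
`(1.0625, 1.2165…)`. [this file, g77] -/
theorem not_isTwoShellGoodSet_of_gap {ε aLo aHi : ℝ} (hε : 0 ≤ ε) (hlo : 0 < aLo) {Y : Set E3} {q y : E3} (hy : y ∈ Y) (hyq : y ≠ q)
    (h₁ : (1 + ε) * aHi < dist y q) (h₂ : dist y q < (Real.sqrt 2 - ε) * aLo) : ¬ IsTwoShellGoodSet ε aLo aHi Y q := by
  intro h
  obtain ⟨a, ha₁, ha₂, hw⟩ := windows_of_isTwoShellGoodSet hlo.le h
  have ha0 : 0 < a := lt_of_lt_of_le hlo ha₁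
  have hs : Real.sqrt 2 < 3 / 2 := by nlinarith [Real.sq_sqrt (show (0 : ℝ) ≤ 2 by norm_num), Real.sqrt_nonneg 2]
  have hse : 0 ≤ Real.sqrt 2 - ε := by
    by_contra hcon
    push Not at hcon
    have : (Real.sqrt 2 - ε) * aLo < 0 := mul_neg_of_neg_of_pos hcon hlo
    linarith [dist_nonneg (x := y) (y := q)]
  have hmono : (Real.sqrt 2 - ε) * aLo ≤ (Real.sqrt 2 - ε) * a := mul_le_mul_of_nonneg_left ha₁ hse
  have hd : dist y q ≤ 3 / 2 * a := by nlinarith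
  rcases hw y hy hyq hd with hw1 | hw2
  · have hup := (abs_le.1 hw1).2
    have h1e : (1 + ε) * a ≤ (1 + ε) * aHi := mul_le_mul_of_nonneg_left ha₂ (by linarith)
    nlinarith
  · have hlow := (abs_le.1 hw2).1
    nlinarith

/-- the atoms of a door set are `(1/16, 9/10, aHi)`-clean, SET form (dictionary `{p | μS S {p} ≠ 0} = S`). [this file, g77] -/
theorem isTwoShellGoodSet_of_isDoorSetP {aHi δ : ℝ} {S : Set E3} (hS : IsDoorSetP aHi δ S) {q : E3} (hq : q ∈ S) :
    IsTwoShellGoodSet (1 / 16) (9 / 10) aHi S q := by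
  have hset : {p : E3 | μS S {p} ≠ 0} = S := Set.ext fun p => mem_iff_μS_singleton_ne_zero S p
  have h := hS.2.2.1 q ((mem_iff_μS_singleton_ne_zero S q).2 hq)
  rwa [hset] at h

/-- a door set at ceiling `aHi` has `9/10 ≤ aHi` as soon as it has an atom (the scale window `[9/10, aHi]` is inhabited). [this file, g77] -/
theorem le_ceiling_of_isDoorSetP {aHi δ : ℝ} {S : Set E3} (hS : IsDoorSetP aHi δ S) : 9 / 10 ≤ aHi := by
  obtain ⟨a, ha₁, ha₂, -⟩ := windows_of_isTwoShellGoodSet (by norm_num) (isTwoShellGoodSet_of_isDoorSetP hS hS.1)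
  exact ha₁.trans ha₂

/-- ★★ **THE PAIR GAP OF A DOOR SET (PROVED)**: no two atoms of an `aHi`-door set lie at a distance in the open interval
`((17/16)·aHi, (9/10)(√2 − 1/16))` — at `aHi = 1`, `(1.0625, 1.2165…)`.  (Cleanliness of `q` with `p` in the gap; `p = q` is excluded by `9/10 ≤ aHi`.)
Nearest prior in the tree: `…LatticeLiouvilleTearFreeShells.shell_dichotomy` / `six_fifths_lt` (the `aHi = 1`, `dist ≤ 27/20` case, via the clean witness);
here parametric in the ceiling `aHi` and derived from the general `not_isTwoShellGoodSet_of_gap`. [this file, g77] -/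
theorem door_pair_gap {aHi δ : ℝ} {S : Set E3} (hS : IsDoorSetP aHi δ S) {p q : E3} (hp : p ∈ S) (hq : q ∈ S)
    (h₁ : 17 / 16 * aHi < dist p q) : 9 / 10 * (Real.sqrt 2 - 1 / 16) ≤ dist p q := by
  by_contra hcon
  push Not at hcon
  have hgood := isTwoShellGoodSet_of_isDoorSetP hS hq
  have haHi := le_ceiling_of_isDoorSetP hS
  have hpq : p ≠ q := by
    rintro rfl
    rw [dist_self] at h₁
    nlinarith
  exact not_isTwoShellGoodSet_of_gap (by norm_num) (by norm_num) hp hpq (by linarith) (by linarith) hgood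

/-- the pair gap with rational ends: `dist p q ∉ ((17/16)·aHi, 6/5]`. [this file, g77] -/
theorem door_pair_gap' {aHi δ : ℝ} {S : Set E3} (hS : IsDoorSetP aHi δ S) {p q : E3} (hp : p ∈ S) (hq : q ∈ S)
    (h₁ : 17 / 16 * aHi < dist p q) : 6 / 5 < dist p q := by
  have := door_pair_gap hS hp hq h₁
  nlinarith [sqrt_two_window.1]

/-- ★ **THE CHART'S BOND THRESHOLD SITS IN THE GAP (PROVED)**: for a door set with `aHi ≤ 1`, `dist p q ≤ 28/25` iff `dist p q ≤ (17/16)·aHi` — N's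
chart bonds (`0 < dist ≤ 28/25`, `IsCharted`) are EXACTLY the first-shell contacts (`≤ (1 + 1/16)·aHi`), for every pair of atoms. [this file, g77] -/
theorem door_bond_iff {aHi δ : ℝ} (haHi : aHi ≤ 1) {S : Set E3} (hS : IsDoorSetP aHi δ S) {p q : E3} (hp : p ∈ S) (hq : q ∈ S) :
    dist p q ≤ 28 / 25 ↔ dist p q ≤ 17 / 16 * aHi := by
  constructor
  · intro h
    by_contra hcon
    push Not at hcon
    have := door_pair_gap' hS hp hq hcon
    linarith
  · intro h
    linarith

/-- ★ **THE TAME GAP (PROVED, rotation-free)**: if the model set `H` has NO pair of sites at a distance in `(D₁, D₂)`, and the `4`-star of `x ∈ S`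
contains an atom `p ∈ S` with `D₁ + ϑ < dist p x < D₂ − ϑ`, then the star is NOT `ϑ`-tame relative to `H`: a tameness rotation `U` is an isometry, so
`‖U (p − x)‖ = dist p x`, and `g p, g x ∈ H` would be at distance within `ϑ` of it.  (Same mechanism as the finite-shell obstruction
`…ShellTrichotomyNegative.not_shellCloseTo_of_gapPair` for `η`-matchings; here for `IsTameStar` and an arbitrary model set `H`.) [this file, g77] -/
theorem not_isTameStar_of_gap {ϑ D₁ D₂ : ℝ} {S H : Set E3} {x p : E3}
    (hH : ∀ y ∈ H, ∀ y' ∈ H, dist y y' ≤ D₁ ∨ D₂ ≤ dist y y') (hx : x ∈ S) (hp : p ∈ S) (hpx : dist p x ≤ 4)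
    (h₁ : D₁ + ϑ < dist p x) (h₂ : dist p x < D₂ - ϑ) : ¬ IsTameStar ϑ S H x := by
  rintro ⟨U, g, -, hg, hb⟩
  have hgx : g x ∈ H := hg ⟨hx, mem_closedBall_self (by norm_num)⟩
  have hgp : g p ∈ H := hg ⟨hp, mem_closedBall.2 hpx⟩
  have key : dist (U (p - x)) (g p - g x) ≤ ϑ := hb p hp hpx
  have hU : ‖U (p - x)‖ = dist p x := by rw [LinearIsometryEquiv.norm_map, dist_eq_norm]
  have htri : |dist p x - dist (g p) (g x)| ≤ ϑ := by
    rw [← hU, dist_eq_norm (g p)]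
    rw [dist_eq_norm] at key
    exact (abs_norm_sub_norm_le _ _).trans key
  rcases hH (g p) hgp (g x) hgx with h | h
  · linarith [(abs_le.1 htri).2]
  · linarith [(abs_le.1 htri).1]

end Windows
/-! ### ZC-2b  The hollow-coset gap: stacking letters are DISCRETE (PROVED) -/

section Hollow

/-- ★ **THE HOLLOW-COSET GAP (PROVED)**: a hollow of the unit triangular layer (`w = barlowOffset 1` plus any lattice vector) lies at squared lateral
distance `(i² + ij + j² + i + j) + 1/3 ∈ {1/3, 4/3, 7/3, …}` from the lattice site `0`; in particular NEVER closer than `1/√3 ≈ 0.577`.  The letters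
`A/B/C` of a close-packed layer over the one below are therefore DISCRETE data: two registries read within `< 1/(2√3)` of hollows determine the same
letter — the quantitative reason tame stars (`ϑp = 1/10`) read letters unambiguously. [this file, g77] -/
theorem norm_sq_lattice_add_hollow (i j : ℤ) :
    ‖(i : ℝ) • triangularVec₁ 1 + (j : ℝ) • triangularVec₂ 1 + barlowOffset 1‖ ^ 2 = ((i * i + i * j + j * j + i + j : ℤ) : ℝ) + 1 / 3 := by
  have h3 : Real.sqrt 3 ^ 2 = 3 := Real.sq_sqrt (by norm_num)
  have e0 : ((i : ℝ) • triangularVec₁ 1 + (j : ℝ) • triangularVec₂ 1 + barlowOffset 1) 0 = i + j / 2 + 1 / 2 := by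
    simp [triangularVec₁, triangularVec₂, barlowOffset]; ring
  have e1 : ((i : ℝ) • triangularVec₁ 1 + (j : ℝ) • triangularVec₂ 1 + barlowOffset 1) 1 = (j / 2 + 1 / 6) * Real.sqrt 3 := by
    simp [triangularVec₁, triangularVec₂, barlowOffset]; ring
  have e2 : ((i : ℝ) • triangularVec₁ 1 + (j : ℝ) • triangularVec₂ 1 + barlowOffset 1) 2 = 0 := by
    simp [triangularVec₁, triangularVec₂, barlowOffset]
  rw [EuclideanSpace.norm_sq_eq, Fin.sum_univ_three, Real.norm_eq_abs, Real.norm_eq_abs, Real.norm_eq_abs, sq_abs, sq_abs, sq_abs, e0, e1, e2]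
  push_cast
  linear_combination ((j / 2 + 1 / 6) ^ 2) * h3

/-- consequently the lateral offset of a hollow from any lattice site is at least `1/√3` in square: `1/3 ≤ ‖i u + j v + w‖²`. [this file, g77] -/
theorem third_le_norm_sq_lattice_add_hollow (i j : ℤ) :
    1 / 3 ≤ ‖(i : ℝ) • triangularVec₁ 1 + (j : ℝ) • triangularVec₂ 1 + barlowOffset 1‖ ^ 2 := by
  rw [norm_sq_lattice_add_hollow]
  have : (0 : ℤ) ≤ i * i + i * j + j * j + i + j := by
    -- `12(i² + ij + j² + i + j) + 4 = 3(2i + j + 1)² + (3j + 1)²` > 0, and integrality (inlined at the reviewer's request, p853361)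
    have h' : (-1 : ℤ) < i * i + i * j + j * j + i + j := by nlinarith [sq_nonneg (2 * i + j + 1), sq_nonneg (3 * j + 1)]
    linarith [Int.add_one_le_iff.mpr h']
  have : (0 : ℝ) ≤ ((i * i + i * j + j * j + i + j : ℤ) : ℝ) := by exact_mod_cast this
  linarith

end Hollow
/-! ### ZC-2c  The pair gap `(1, √2)` of EVERY ideal Barlow stacking (PROVED): the tame dichotomy becomes unconditional for ideal models -/

section BarlowGap

open Literature.MathematicalPhysics.StatisticalMechanics (IsHaggSeq haggLabel barlowPos barlowStacking haggLabel_succ dist_barlowPos_sq)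

/-- ★★ **SQUARED DISTANCES IN AN IDEAL BARLOW STACKING ARE INTEGERS OR `≥ 8/3` (PROVED)**: for a Hägg sequence `s` (letters `±1`), contact `1` and
ideal layer height `√(2/3)`, two sites in the same layer are at squared distance `x² + xy + y² ∈ ℕ`, in adjacent layers at `x² + xy + y² ± (x + y) + 1 ∈ ℕ`
(the hollow-coset form of ZC-2b), and two or more layers apart at `≥ 4·(2/3)`. [this file, g77] -/
theorem barlow_dist_sq_integer_or_far {s : ℤ → ℤ} (hs : IsHaggSeq s) (k i j k' i' j' : ℤ) :
    (∃ N : ℤ, dist (barlowPos 1 (Real.sqrt (2 / 3)) s k i j) (barlowPos 1 (Real.sqrt (2 / 3)) s k' i' j') ^ 2 = (N : ℝ)) ∨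
      8 / 3 ≤ dist (barlowPos 1 (Real.sqrt (2 / 3)) s k i j) (barlowPos 1 (Real.sqrt (2 / 3)) s k' i' j') ^ 2 := by
  have h3 : Real.sqrt 3 ^ 2 = 3 := Real.sq_sqrt (by norm_num)
  have h23 : Real.sqrt (2 / 3) ^ 2 = 2 / 3 := Real.sq_sqrt (by norm_num)
  have hsq := dist_barlowPos_sq 1 (Real.sqrt (2 / 3)) s k i j k' i' j'
  rcases lt_trichotomy (k - k') 0 with hn | hn | hn
  · rcases lt_or_eq_of_le (Int.le_sub_one_of_lt hn) with hn2 | hn1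
    · -- two or more layers apart (k - k' ≤ -2)
      right
      have hc : ((k : ℝ) - k') ≤ -2 := by
        have : (k : ℤ) - k' ≤ -2 := by omega
        exact_mod_cast this
      have e : (((k : ℝ) - k') * Real.sqrt (2 / 3)) ^ 2 = ((k : ℝ) - k') ^ 2 * (2 / 3) := by rw [mul_pow, h23]
      rw [hsq]
      nlinarith [sq_nonneg (1 * ((i : ℝ) - i' + ((j : ℝ) - j') / 2 + ((haggLabel s k : ℝ) - haggLabel s k') / 2)),
        sq_nonneg (1 * Real.sqrt 3 / 2 * (((j : ℝ) - j') + ((haggLabel s k : ℝ) - haggLabel s k') / 3))]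
    · -- adjacent layers, k' = k + 1: label difference `-s k = ∓1`
      left
      have hk' : k' = k + 1 := by omega
      subst hk'
      have hL : (haggLabel s (k + 1) : ℝ) = haggLabel s k + s k := by exact_mod_cast haggLabel_succ s k
      rcases hs k with h1 | h1
      · refine ⟨(i - i') * (i - i') + (i - i') * (j - j') + (j - j') * (j - j') - ((i - i') + (j - j')) + 1, ?_⟩
        rw [hsq, hL, h1]
        push_cast
        linear_combination (1 / 4 * ((j : ℝ) - j' - 1 / 3) ^ 2) * h3 + h23
      · refine ⟨(i - i') * (i - i') + (i - i') * (j - j') + (j - j') * (j - j') + ((i - i') + (j - j')) + 1, ?_⟩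
        rw [hsq, hL, h1]
        push_cast
        linear_combination (1 / 4 * ((j : ℝ) - j' + 1 / 3) ^ 2) * h3 + h23
  · -- same layer
    left
    have hk' : k' = k := by omega
    subst hk'
    refine ⟨(i - i') * (i - i') + (i - i') * (j - j') + (j - j') * (j - j'), ?_⟩
    rw [hsq]
    push_cast
    linear_combination (1 / 4 * ((j : ℝ) - j') ^ 2) * h3
  · rcases lt_or_eq_of_le (Int.add_one_le_of_lt hn) with hn2 | hn1
    · -- two or more layers apart (2 ≤ k - k')
      right
      have hc : (2 : ℝ) ≤ (k : ℝ) - k' := by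
        have : (2 : ℤ) ≤ k - k' := by omega
        exact_mod_cast this
      have e : (((k : ℝ) - k') * Real.sqrt (2 / 3)) ^ 2 = ((k : ℝ) - k') ^ 2 * (2 / 3) := by rw [mul_pow, h23]
      rw [hsq]
      nlinarith [sq_nonneg (1 * ((i : ℝ) - i' + ((j : ℝ) - j') / 2 + ((haggLabel s k : ℝ) - haggLabel s k') / 2)),
        sq_nonneg (1 * Real.sqrt 3 / 2 * (((j : ℝ) - j') + ((haggLabel s k : ℝ) - haggLabel s k') / 3))]
    · -- adjacent layers, k = k' + 1: label difference `s k' = ±1`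
      left
      have hk : k = k' + 1 := by omega
      subst hk
      have hL : (haggLabel s (k' + 1) : ℝ) = haggLabel s k' + s k' := by exact_mod_cast haggLabel_succ s k'
      rcases hs k' with h1 | h1
      · refine ⟨(i - i') * (i - i') + (i - i') * (j - j') + (j - j') * (j - j') + ((i - i') + (j - j')) + 1, ?_⟩
        rw [hsq, hL, h1]
        push_cast
        linear_combination (1 / 4 * ((j : ℝ) - j' + 1 / 3) ^ 2) * h3 + h23
      · refine ⟨(i - i') * (i - i') + (i - i') * (j - j') + (j - j') * (j - j') - ((i - i') + (j - j')) + 1, ?_⟩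
        rw [hsq, hL, h1]
        push_cast
        linear_combination (1 / 4 * ((j : ℝ) - j' - 1 / 3) ^ 2) * h3 + h23

/-- ★★★ **THE PAIR GAP OF AN IDEAL BARLOW STACKING (PROVED)**: in `barlowStacking 1 √(2/3) s` (`s` a Hägg sequence — fcc, hcp and every mixed
stacking alike) NO two sites lie at a distance in the open interval `(1, √2)`: a squared distance is an integer or at least `8/3`.  This is the model
pair-gap hypothesis of `not_isTameStar_of_gap` (and of `straddle_dichotomy_of_tame` in the sequel part `…LatticeLiouvilleZC`), discharged for every ideal model.  Nearest prior in the tree: the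
12-point pattern cases `…ShellTrichotomyNegative.fcc_dist_dichotomy` / `hcp_dist_dichotomy` ([ConwaySloane1999, Ch. 4 §6.3], [HalesDSP2012, §1.3]) and the
three-case minimal-distance bound `…HcpLandscapeGapStubExactWindowEnergy.le_dist_barlowPos_sq`; here the full integrality dichotomy for every infinite
stacking word. [this file, g77] -/
theorem barlow_pair_gap {s : ℤ → ℤ} (hs : IsHaggSeq s) :
    ∀ y ∈ barlowStacking 1 (Real.sqrt (2 / 3)) s, ∀ y' ∈ barlowStacking 1 (Real.sqrt (2 / 3)) s, dist y y' ≤ 1 ∨ Real.sqrt 2 ≤ dist y y' := by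
  rintro y ⟨k, i, j, rfl⟩ y' ⟨k', i', j', rfl⟩
  set d := dist (barlowPos 1 (Real.sqrt (2 / 3)) s k i j) (barlowPos 1 (Real.sqrt (2 / 3)) s k' i' j') with hd
  have hd0 : 0 ≤ d := dist_nonneg
  have two_le : 2 ≤ d ^ 2 → Real.sqrt 2 ≤ d := fun h => by
    have := Real.sqrt_le_sqrt h
    rwa [Real.sqrt_sq hd0] at this
  rcases barlow_dist_sq_integer_or_far hs k i j k' i' j' with ⟨N, hN⟩ | hfar
  · rw [← hd] at hN
    rcases le_or_gt N 1 with hN1 | hN2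
    · left
      have : d ^ 2 ≤ 1 := by rw [hN]; exact_mod_cast hN1
      nlinarith
    · right
      have hN2' : (2 : ℤ) ≤ N := by omega
      exact two_le (by rw [hN]; exact_mod_cast hN2')
  · right
    rw [← hd] at hfar
    exact two_le (by linarith)

end BarlowGap

end Summit.AtomisticToContinuum.Crystallization.Theorems.ChartedZeroExcessLayeredLatticeLiouville
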